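import Literature.NumberTheory.Automorphic.StrongArtinGL2GlobalQuotientProofs
import Literature.NumberTheory.Automorphic.SatakeParamNeZeroProofs
import Mathlib.Analysis.Meromorphic.Basic
import Mathlib.Analysis.SpecialFunctions.Gamma.Deligne
import HarnessLib

/-!
# Gelbart's Prop. 4.1: the quotient of the functional equations, meromorphic form
(pure proofs; companion to `Automorphic/StrongArtinGL2GlobalQuotientProofs`)

`StrongArtinGL2GlobalQuotientProofs` proves Gelbart's Prop. 4.1 at a place `v`
(`frobSatake_of_global_functional_equations`) from a *global analytic package*: four functions
holomorphic off a closed countable set `P` stable under `s ↦ 1 - s`, entire reciprocal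
archimedean factors vanishing on finitely many horizontal lines, Euler-product agreements on a
right half-plane and the two functional equations off `P`.  This file restates the package in
the form in which the tree's L-function predicates deliver it — Mathlib-`Meromorphic` functions
satisfying their functional equations pointwise on `ℂ` (as in
`GaloisRepresentations.ArtinRep.SatisfiesFunctionalEquation`), archimedean factors given as
finite products `∏_{m ∈ μ} Γ_ℝ(s + m)` (every archimedean `L`-factor of `GL₁`, `GL₂` over `ℝ` or
`ℂ` is of this shape, `Γ_ℂ(s) = Γ_ℝ(s) Γ_ℝ(s + 1)`, Mathlib `Complex.Gammaℝ_mul_Gammaℝ_add_one`):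

* `exists_isClosed_countable_analyticAt` — the singular sets of four meromorphic functions on
  `ℂ` and their reflections in `s ↦ 1 - s` form a closed countable set (Mathlib
  `Meromorphic.countable_compl_analyticAt`, `isOpen_analyticAt`).
* `differentiable_multiset_prod_Gammaℝ_inv`, `im_mem_of_multiset_prod_Gammaℝ_inv_eq_zero` — the
  reciprocal archimedean factor `s ↦ ∏_{m ∈ μ} Γ_ℝ(s + m)⁻¹` is entire (Mathlib
  `Complex.differentiable_Gammaℝ_inv`) and vanishes only on the horizontal lines `im s = -im m`
  (`Complex.Gammaℝ_eq_zero_iff`).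
* `frobSatake_of_meromorphic_functional_equations` — Prop. 4.1 at `v` from: `Λ_π, Λ_σ, Λ_π', Λ_σ'`
  meromorphic on `ℂ` with `Λ_π(s) = ε_π(s) Λ_π'(1 - s)`, `Λ_σ(s) = ε_σ(s) Λ_σ'(1 - s)` for all `s`
  (`ε_•` continuous, `ε_σ` nowhere zero), agreeing Euler factors off `v, ∞` in the cross-multiplied
  form `Λ_π(s) ∏_{a ∈ α}(1 - a q^{-s}) ∏_{m ∈ μ_π} Γ_ℝ(s + m)⁻¹ = Λ_σ(s) L_v(σ, q^{-s}) ∏_{m ∈ μ_σ} Γ_ℝ(s + m)⁻¹`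
  and `Λ_π'(s) ∏_{a ∈ α}(1 - a⁻¹ q^{-s}) ∏_{m ∈ μ_π'} Γ_ℝ(s + m)⁻¹ = Λ_σ'(s) A_σ'(s)` for `re s > c`,
  and `Λ_π'` non-zero at some point of analyticity (Jacquet–Langlands 1970, pp. 209–211).
* `frobSatakeCompatibleAt_of_isPiOfArtinRep_of_meromorphic_functional_equations` — the named fact
  `frobSatakeCompatibleAt_of_isPiOfArtinRep` from the existence of this data (displayed inline)
  for every cuspidal `π = π(σ)` with Satake parameter `α` at `v`, `α` generic (that `0 ∉ α` is the
  theorem `hasSatakeParamAt_ne_zero_holds` of `SatakeParamNeZeroProofs`, Cartier 1979 §IV.2).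

No new definition and no named fact is introduced (D-0026).

## References

* H. Jacquet, R. P. Langlands, *Automorphic Forms on GL(2)*, LNM 114 (1970): proof of Thm. 12.2,
  pp. 209–211 (retypeset ed.), Thm. 11.1, Cor. 11.2, Lemma 12.5. [JacquetLanglands1970]
* S. Gelbart, *Three lectures on the modularity of `ρ̄_{E,3}` …* (1997): Prop. 4.1. [Gelbart1997]
* J. Neukirch, *Algebraic Number Theory* (1999), VII §12 (archimedean factors `L_∞`). [NeukirchANT1999]
-/

noncomputable section

open scoped MatrixGroups NumberField Polynomial
open NumberField IsDedekindDomain Field Polynomial Complex Filter Topology Set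
open Literature.NumberTheory.GaloisRepresentations (ArtinRep FramedArtinRep)
open Literature.NumberTheory.LFunctions

namespace Literature.NumberTheory.Automorphic

/-! ### The singular set of finitely many meromorphic functions -/

section Singular

/-- The singular set `{z | ¬ AnalyticAt ℂ f z}` of a meromorphic function on `ℂ` is closed and
countable (Mathlib `isOpen_analyticAt`, `Meromorphic.countable_compl_analyticAt`). [folklore] -/
theorem isClosed_countable_compl_analyticAt {f : ℂ → ℂ} (hf : Meromorphic f) :
    IsClosed {z | AnalyticAt ℂ f z}ᶜ ∧ {z | AnalyticAt ℂ f z}ᶜ.Countable :=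
  ⟨(isOpen_analyticAt ℂ f).isClosed_compl, hf.countable_compl_analyticAt⟩

/-- **A common exceptional set.**  For four meromorphic functions on `ℂ` there is a closed
countable set `P`, stable under `s ↦ 1 - s`, off which all four are analytic: the union of the
four singular sets and of their reflections. [folklore] -/
theorem exists_isClosed_countable_analyticAt {Λ₁ Λ₂ Λ₃ Λ₄ : ℂ → ℂ} (h₁ : Meromorphic Λ₁)
    (h₂ : Meromorphic Λ₂) (h₃ : Meromorphic Λ₃) (h₄ : Meromorphic Λ₄) :
    ∃ P : Set ℂ, IsClosed P ∧ P.Countable ∧ (∀ s ∈ P, 1 - s ∈ P) ∧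
      ∀ s, s ∉ P → AnalyticAt ℂ Λ₁ s ∧ AnalyticAt ℂ Λ₂ s ∧ AnalyticAt ℂ Λ₃ s ∧ AnalyticAt ℂ Λ₄ s := by
  set N : Set ℂ := {z | AnalyticAt ℂ Λ₁ z}ᶜ ∪ {z | AnalyticAt ℂ Λ₂ z}ᶜ ∪ {z | AnalyticAt ℂ Λ₃ z}ᶜ ∪
    {z | AnalyticAt ℂ Λ₄ z}ᶜ with hN
  have hNc : IsClosed N :=
    (((isClosed_countable_compl_analyticAt h₁).1.union (isClosed_countable_compl_analyticAt h₂).1).union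
      (isClosed_countable_compl_analyticAt h₃).1).union (isClosed_countable_compl_analyticAt h₄).1
  have hNco : N.Countable :=
    (((isClosed_countable_compl_analyticAt h₁).2.union (isClosed_countable_compl_analyticAt h₂).2).union
      (isClosed_countable_compl_analyticAt h₃).2).union (isClosed_countable_compl_analyticAt h₄).2
  have h1s : Continuous fun s : ℂ => 1 - s := continuous_const.sub continuous_id
  have hinj : Function.Injective fun s : ℂ => 1 - s := fun a b h => by simpa using h
  refine ⟨N ∪ (fun s : ℂ => 1 - s) ⁻¹' N, hNc.union (hNc.preimage h1s),
    hNco.union (hNco.preimage hinj), ?_, ?_⟩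
  · rintro s (hs | hs)
    · exact Or.inr (by simpa using hs)
    · exact Or.inl hs
  · intro s hs
    simp only [hN, mem_union, mem_preimage, mem_compl_iff, mem_setOf_eq, not_or, not_not] at hs
    exact ⟨hs.1.1.1.1, hs.1.1.1.2, hs.1.1.2, hs.1.2⟩

end Singular

/-! ### Reciprocal archimedean factors `∏ Γ_ℝ(s + m)⁻¹` -/

section Archimedean

/-- `s ↦ ∏_{m ∈ μ} Γ_ℝ(s + m)⁻¹` is entire (`1/Γ_ℝ` is entire, Mathlib
`Complex.differentiable_Gammaℝ_inv`). [folklore] -/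
theorem differentiable_multiset_prod_Gammaℝ_inv (μ : Multiset ℂ) :
    Differentiable ℂ fun s : ℂ => (μ.map fun m => (Gammaℝ (s + m))⁻¹).prod := by
  induction μ using Multiset.induction_on with
  | empty => simp
  | cons m μ ih =>
      simp only [Multiset.map_cons, Multiset.prod_cons]
      exact (differentiable_Gammaℝ_inv.comp (differentiable_id.add_const m)).fun_mul ih

/-- The zeros of `s ↦ ∏_{m ∈ μ} Γ_ℝ(s + m)⁻¹` lie on the finitely many horizontal lines
`im s = -im m`, `m ∈ μ`: `Γ_ℝ(s + m)⁻¹ = 0` iff `s + m ∈ -2ℕ` (Mathlib `Complex.Gammaℝ_eq_zero_iff`).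
[folklore] -/
theorem im_mem_of_multiset_prod_Gammaℝ_inv_eq_zero (μ : Multiset ℂ) {s : ℂ}
    (hs : (μ.map fun m => (Gammaℝ (s + m))⁻¹).prod = 0) :
    s.im ∈ (fun m : ℂ => -m.im) '' {m | m ∈ μ} := by
  obtain ⟨x, hx, hx0⟩ := Multiset.prod_eq_zero_iff.mp hs |> Multiset.mem_map.mp
  obtain ⟨n, hn⟩ := Gammaℝ_eq_zero_iff.mp (inv_eq_zero.mp hx0)
  refine ⟨x, hx, ?_⟩
  have h := congrArg Complex.im hn
  simp only [add_im, neg_im] at h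
  have h2 : ((2 : ℂ) * (n : ℂ)).im = 0 := by simp
  rw [h2, neg_zero] at h
  linarith

/-- The set of horizontal lines of `im_mem_of_multiset_prod_Gammaℝ_inv_eq_zero` is finite.
[folklore] -/
theorem finite_image_neg_im (μ : Multiset ℂ) : ((fun m : ℂ => -m.im) '' {m | m ∈ μ}).Finite :=
  (μ.finite_toSet).image _

end Archimedean

/-! ### Prop. 4.1 at `v` from meromorphic functional equations -/

section OnePlace

variable {F : Type*} [Field F] [NumberField F]

/-- **Gelbart's Prop. 4.1 at one place from meromorphic functional equations**
(Jacquet–Langlands 1970, proof of Thm. 12.2, pp. 209–211, in the form delivered by the tree's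
L-function predicates).  Let `σ : Γ_F → GL₂(ℂ)` be an Artin representation, `v` a finite place,
`q = N v`, `α` a multiset of two non-zero complex numbers with `a ≠ q b` for `a, b ∈ α`.  Suppose
given meromorphic functions `Λ_π, Λ_σ, Λ_π', Λ_σ'` on `ℂ` (the completed `L(s, ω ⊗ π)`,
`L(s, ω ⊗ σ)`, `L(s, ω⁻¹ ⊗ π̃)`, `L(s, ω⁻¹ ⊗ σ̃)` for an idèle class character `ω` trivial at `v`),
multisets `μ_π, μ_σ, μ_π'` (the archimedean data: `L_∞ = ∏_{m ∈ μ} Γ_ℝ(s + m)`), an entire `A_σ'`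
(the reciprocal of the remaining factors of the fourth), continuous `ε_π, ε_σ` with `ε_σ` nowhere
zero, such that: for `re s > c`,
`Λ_π(s) ∏_{a ∈ α}(1 - a q^{-s}) ∏_{m ∈ μ_π} Γ_ℝ(s + m)⁻¹ = Λ_σ(s) L_v(σ, q^{-s}) ∏_{m ∈ μ_σ} Γ_ℝ(s + m)⁻¹`
and `Λ_π'(s) ∏_{a ∈ α}(1 - a⁻¹ q^{-s}) ∏_{m ∈ μ_π'} Γ_ℝ(s + m)⁻¹ = Λ_σ'(s) A_σ'(s)` (the Euler
factors at the places `≠ v, ∞` agree: `π = π(σ)` at the unramified ones, and all local factors are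
`1` at the other exceptional places, `ω` being highly ramified there — Lemma 12.5); the functional
equations `Λ_π(s) = ε_π(s) Λ_π'(1 - s)` (Thm. 11.1, Cor. 11.2) and `Λ_σ(s) = ε_σ(s) Λ_σ'(1 - s)`
(Artin) for all `s`; and `Λ_π'(s₀) ≠ 0` at some point `s₀` of analyticity.  Then `σ` is unramified
at `v` with `charpoly σ(Frob_v) = ∏_{a ∈ α} (X - a)`.  Proof: off the common exceptional set `P`
(`exists_isClosed_countable_analyticAt`) this is the package of
`frobSatake_of_global_functional_equations`; `Λ_π' ≢ 0` off `P` because `Λ_π'` is non-zero near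
`s₀` and `ℂ ∖ P` is dense. [cite: JacquetLanglands1970, proof of Thm. 12.2, pp. 209–211] -/
theorem frobSatake_of_meromorphic_functional_equations (σ : FramedArtinRep F 2)
    (v : HeightOneSpectrum (𝓞 F)) {α : Multiset ℂ} (hcard : Multiset.card α = 2)
    (h0 : (0 : ℂ) ∉ α) (hgen : ∀ a ∈ α, ∀ b ∈ α, a ≠ v.residueCard * b)
    {Λπ Λσ Λπ' Λσ' : ℂ → ℂ} (hΛπ : Meromorphic Λπ) (hΛσ : Meromorphic Λσ)
    (hΛπ' : Meromorphic Λπ') (hΛσ' : Meromorphic Λσ') (μπ μσ μπ' : Multiset ℂ)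
    {Aσ' επ εσ : ℂ → ℂ} (hAσ' : Differentiable ℂ Aσ') (hεπ : Continuous επ)
    (hεσ : Continuous εσ) (hεσ0 : ∀ s, εσ s ≠ 0) {c : ℝ}
    (hE : ∀ s : ℂ, c < s.re →
      Λπ s * ((α.map fun a => eulerTerm v.residueCard a s).prod *
          (μπ.map fun m => (Gammaℝ (s + m))⁻¹).prod) =
        Λσ s * ((σ.toArtinRep.eulerFactorAt v).eval ((v.residueCard : ℂ) ^ (-s)) *
          (μσ.map fun m => (Gammaℝ (s + m))⁻¹).prod))
    (hE' : ∀ s : ℂ, c < s.re →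
      Λπ' s * ((α.map fun a => eulerTerm v.residueCard a⁻¹ s).prod *
          (μπ'.map fun m => (Gammaℝ (s + m))⁻¹).prod) = Λσ' s * Aσ' s)
    (hFπ : ∀ s, Λπ s = επ s * Λπ' (1 - s)) (hFσ : ∀ s, Λσ s = εσ s * Λσ' (1 - s))
    (hNV : ∃ s, AnalyticAt ℂ Λπ' s ∧ Λπ' s ≠ 0) :
    σ.IsUnramifiedAt v ∧ σ.HasFrobCharpolyAt v (satakePolynomial α) := by
  obtain ⟨P, hPc, hP, hPs, hPa⟩ := exists_isClosed_countable_analyticAt hΛπ hΛσ hΛπ' hΛσ'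
  -- `Λ_π' ≢ 0` off `P`: non-zero near `s₀`, and `ℂ ∖ P` is dense
  have hNV' : ∃ s, s ∉ P ∧ Λπ' s ≠ 0 := by
    obtain ⟨s₀, hs₀a, hs₀⟩ := hNV
    obtain ⟨s, hsP, hs⟩ := (Set.Countable.dense_compl ℂ hP).inter_nhds_nonempty
      (hs₀a.continuousAt.preimage_mem_nhds (isOpen_ne.mem_nhds hs₀))
    exact ⟨s, hsP, hs⟩
  have hd : ∀ {Λ : ℂ → ℂ}, (∀ s, s ∉ P → AnalyticAt ℂ Λ s) → DifferentiableOn ℂ Λ Pᶜ :=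
    fun h s hs => (h s hs).differentiableAt.differentiableWithinAt
  exact frobSatake_of_global_functional_equations σ v hcard h0 hgen hPc hP hPs
    (hd fun s hs => (hPa s hs).1) (hd fun s hs => (hPa s hs).2.1)
    (hd fun s hs => (hPa s hs).2.2.1) (hd fun s hs => (hPa s hs).2.2.2)
    (Γπ := fun s => (μπ.map fun m => (Gammaℝ (s + m))⁻¹).prod)
    (Γσ := fun s => (μσ.map fun m => (Gammaℝ (s + m))⁻¹).prod)
    (Γπ' := fun s => (μπ'.map fun m => (Gammaℝ (s + m))⁻¹).prod)
    (differentiable_multiset_prod_Gammaℝ_inv μπ) (differentiable_multiset_prod_Gammaℝ_inv μσ)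
    (differentiable_multiset_prod_Gammaℝ_inv μπ') hAσ' hεπ hεσ hεσ0
    ⟨_, finite_image_neg_im μσ, fun s hs => im_mem_of_multiset_prod_Gammaℝ_inv_eq_zero μσ hs⟩
    ⟨_, finite_image_neg_im μπ', fun s hs => im_mem_of_multiset_prod_Gammaℝ_inv_eq_zero μπ' hs⟩
    (fun s hs _ => hE s hs) (fun s hs _ => hE' s hs) (fun s _ => hFπ s) (fun s _ => hFσ s) hNV'

end OnePlace

/-! ### Consequence for the named fact -/

section NamedFact

open scoped Classical

/-- **Prop. 4.1 from meromorphic functional equations.**  The named fact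
`frobSatakeCompatibleAt_of_isPiOfArtinRep` follows from the statement — displayed inline as the
hypothesis `H`; it is what Jacquet–Langlands 1970, Thm. 11.1 and Cor. 11.2 (entire continuation
and functional equation of `L(s, ω ⊗ π)` for the cuspidal `π` and every idèle class character
`ω`), Artin–Brauer (meromorphic continuation and functional equation of `L(s, ω ⊗ σ)`),
Lemma 12.5 (an `ω` trivial at `v` and so ramified at the other exceptional finite places that
all local factors there are `1`) and `π = π(σ)` at the unramified places provide — that whenever
the cuspidal `π = π(σ)` has Satake parameter `α` at `v`, `α` is generic (`a ≠ q_v b`; Satake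
parameters are non-zero by `hasSatakeParamAt_ne_zero_holds`) and the data of
`frobSatake_of_meromorphic_functional_equations` exist at `v`.
[cite: JacquetLanglands1970, proof of Thm. 12.2, pp. 209–211] [cite: Gelbart1997, Prop. 4.1] -/
theorem frobSatakeCompatibleAt_of_isPiOfArtinRep_of_meromorphic_functional_equations
    (H : ∀ {F : Type} [Field F] [NumberField F] (hcpt : isCompact_glFiniteIntegralLevel 2 F)
      (σ : FramedArtinRep F 2) (π : CuspidalAutomorphicRepData 2 F hcpt),
      IsPiOfArtinRep σ π.1 → ∀ (v : HeightOneSpectrum (𝓞 F)) (α : Multiset ℂ),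
        π.1.HasSatakeParamAt v α →
        (∀ a ∈ α, ∀ b ∈ α, a ≠ v.residueCard * b) ∧
        ∃ (Λπ Λσ Λπ' Λσ' Aσ' επ εσ : ℂ → ℂ) (μπ μσ μπ' : Multiset ℂ) (c : ℝ),
          Meromorphic Λπ ∧ Meromorphic Λσ ∧ Meromorphic Λπ' ∧ Meromorphic Λσ' ∧
          Differentiable ℂ Aσ' ∧ Continuous επ ∧ Continuous εσ ∧ (∀ s, εσ s ≠ 0) ∧
          (∀ s : ℂ, c < s.re →
            Λπ s * ((α.map fun a => eulerTerm v.residueCard a s).prod *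
                (μπ.map fun m => (Gammaℝ (s + m))⁻¹).prod) =
              Λσ s * ((σ.toArtinRep.eulerFactorAt v).eval ((v.residueCard : ℂ) ^ (-s)) *
                (μσ.map fun m => (Gammaℝ (s + m))⁻¹).prod)) ∧
          (∀ s : ℂ, c < s.re →
            Λπ' s * ((α.map fun a => eulerTerm v.residueCard a⁻¹ s).prod *
                (μπ'.map fun m => (Gammaℝ (s + m))⁻¹).prod) = Λσ' s * Aσ' s) ∧
          (∀ s, Λπ s = επ s * Λπ' (1 - s)) ∧ (∀ s, Λσ s = εσ s * Λσ' (1 - s)) ∧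
          (∃ s, AnalyticAt ℂ Λπ' s ∧ Λπ' s ≠ 0)) :
    frobSatakeCompatibleAt_of_isPiOfArtinRep := by
  intro F _ _ hcpt σ π hπ v α hα
  obtain ⟨hgen, Λπ, Λσ, Λπ', Λσ', Aσ', επ, εσ, μπ, μσ, μπ', c, hΛπ, hΛσ, hΛπ', hΛσ', hAσ',
    hεπ, hεσ, hεσ0, hE, hE', hFπ, hFσ, hNV⟩ := H hcpt σ π hπ v α hα
  have h0 : (0 : ℂ) ∉ α := fun h => hasSatakeParamAt_ne_zero_holds hα 0 h rfl
  exact frobSatake_of_meromorphic_functional_equations σ v hα.card_eq h0 hgen hΛπ hΛσ hΛπ' hΛσ'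
    μπ μσ μπ' hAσ' hεπ hεσ hεσ0 hE hE' hFπ hFσ hNV

end NamedFact


end Literature.NumberTheory.Automorphic
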